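import Summits.CriticalPhenomena.PercolationContinuityZ3.Theorems.PercNearOneGluingNoHeavyLowerTailSunflowerThreeBlockCombIntervalTables
import HarnessLib
import HarnessLib.Audit

/-!
# `NoHeavyLowerTail` (crux stmt-CriticalPhenomena-4575), abstract sunflower cubic: the THREE-BLOCK theorem IV — a KERNEL-CHECKABLE branch and bound
# (interval propagation in the diamond `M₃` + termwise interval bounds) and its soundness; standard axioms throughout

Support file (seat `prim-ineq-gen-2` gen 21; `--supports stmt-CriticalPhenomena-4575`; sequel of `…SunflowerThreeBlockCombChecker`, p278267).  No `sorry`,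
no named facts, NO compiled evaluation: every computation in this chain is `decide` / `decide +kernel` at default heartbeats.  Memo:
run/shared/lean/prim/prim-ineq-gen-2/THREEBLOCK-LEAN-GEN21.md §8.

PURPOSE.  Part III (`…SunflowerThreeBlockComb`, p279797) closed the three-block theorem with ONE `native_decide` over the `595 433`-leaf depth-first search of part
II.  This file replaces plain enumeration by BRANCH AND BOUND, whose whole search tree has `5 434` nodes — small enough for the KERNEL:
* STATE: one INTERVAL `[lo, hi]` of the diamond `M₃` per cell (companion `…IntervalTables`: `memIv`, `raiseIv`, `lowerIv`, `singIv`); assigning cell `d := x` raises the lower bounds of the later cells above `d` and lowers the upper bounds of the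
  later cells below `d` (`propK`, literal tables `upLaterA`/`downLaterA` with their soundness `…_spec` by `decide`);
* BOUND: every transversal term is at least the minimum of the kernel over its three intervals (`minH/minG/minT` of the companion file), so `bndK` (all three interval sums `≥ 0`) certifies every map inside the intervals at once;
* SEARCH `dfsK` (canonical petal names as in part II) and the chunked TOP SEARCH `dfsTop` (an oracle list of prefixes delegated to separately checked chunks
  `dfsFromK pre`, states recomputed by `stateOfK`);
* SOUNDNESS (`dfsK_sound`, `dfsTop_sound`, induction on the fuel; invariant `InvK`: the labels of the good map lie in the intervals): along a good map the
  branch of its next value is admissible and alive, so success forces `0 ≤ T0 κ ψ`; **`comb_height_two_of_dfsTop`**: a successful chunked search gives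
  COMB_chain of every height-two three-block quotient for `s6H, s6G, s6T` (via part I's `exists_good`, `Tgen_eq_six_mul_T0`, `comb_of_Tgen`).
The chunks (`48` subtrees of ≤ `380` nodes, three files `…IntervalChunksA/B/C`) and the top search + the unconditional standard-axiom theorems
(`…SunflowerThreeBlockCombStandard`) follow.
-/

namespace Summit.CriticalPhenomena.PercolationContinuityZ3.Theorems.SunflowerPartition

open Finset

namespace ThreeBlockComb

open ChainComb

/-! ## §2. The search -/

/-- Later cells ABOVE each cell in the search order (their lower bounds are raised). [this work] -/
def upLaterA : Array (List ℕ) :=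
  #[[1, 2, 3, 4, 5, 6, 7, 8, 9, 10, 11, 12, 13, 14, 15, 16, 17, 18, 19, 20, 21, 22, 23, 24, 25, 26], [],
    [5, 6, 7, 8, 9, 11, 14, 15, 16, 17, 18, 20, 21, 22, 23, 25], [5, 6, 7, 9, 10, 12, 14, 15, 16, 18, 19, 20, 21, 23, 24, 26],
    [5, 6, 7, 11, 12, 13, 15, 16, 17, 18, 19, 22, 23, 24, 25, 26], [], [], [], [14, 15, 17, 20, 22], [14, 15, 16, 18, 20, 21, 23],
    [14, 16, 19, 21, 24], [15, 16, 17, 18, 22, 23, 25], [15, 16, 18, 19, 23, 24, 26], [17, 18, 19, 25, 26], [], [], [], [], [], [], [], [],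
    [], [], [], [], []]

/-- Later cells BELOW each cell in the search order (their upper bounds are lowered). [this work] -/
def downLaterA : Array (List ℕ) :=
  #[[], [2, 3, 4, 5, 6, 7, 8, 9, 10, 11, 12, 13, 14, 15, 16, 17, 18, 19, 20, 21, 22, 23, 24, 25, 26], [], [], [],
    [8, 9, 10, 11, 12, 14, 15, 16, 20, 21, 22, 23, 24], [8, 9, 11, 12, 13, 15, 17, 18, 20, 22, 23, 25, 26],
    [9, 10, 11, 12, 13, 16, 18, 19, 21, 23, 24, 25, 26], [], [], [], [], [], [], [20, 21], [20, 22, 23], [21, 23, 24], [22, 25],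
    [23, 25, 26], [24, 26], [], [], [], [], [], [], []]

/-- Soundness of the `upLater` table: listed cells are above. [this work] -/
theorem upLaterA_spec : ∀ d < 27, ∀ e ∈ upLaterA.getD d [], leB (cellAt d) (cellAt e) = true := by
  unfold upLaterA cellAt cellList leB; decide

/-- Soundness of the `downLater` table: listed cells are below. [this work] -/
theorem downLaterA_spec : ∀ d < 27, ∀ e ∈ downLaterA.getD d [], leB (cellAt e) (cellAt d) = true := by
  unfold downLaterA cellAt cellList leB; decide

/-- The state: one interval per cell (search order). [this work] -/
abbrev KState := List (Fin 13)

/-- Reading the interval of a cell (full interval by default). [this work] -/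
def ivAt (st : KState) (e : ℕ) : Fin 13 := st.getD e topIv

/-- Raise the lower bounds of a list of cells. [this work] -/
def raiseAll (x : Fin 5) : List ℕ → KState → KState
  | [], st => st
  | e :: es, st => raiseAll x es (st.set e (raiseIv (ivAt st e) x))

/-- Lower the upper bounds of a list of cells. [this work] -/
def lowerAll (x : Fin 5) : List ℕ → KState → KState
  | [], st => st
  | e :: es, st => lowerAll x es (st.set e (lowerIv (ivAt st e) x))

/-- Propagation of the assignment `cell d := x`. [this work] -/
def propK (d : ℕ) (x : Fin 5) (st : KState) : KState :=
  lowerAll x (downLaterA.getD d []) (raiseAll x (upLaterA.getD d []) (st.set d (singIv x)))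

/-- The three interval lower bounds of the reduced generic sums (one pass over the `36` transversal triples). [this work] -/
def bsum3 (st : KState) : ℤ × ℤ × ℤ :=
  ∑ q : Fin 36,
    (minH (ivAt st (tripA.getD q.val (0, 0, 0)).1) (ivAt st (tripA.getD q.val (0, 0, 0)).2.1) (ivAt st (tripA.getD q.val (0, 0, 0)).2.2),
     minG (ivAt st (tripA.getD q.val (0, 0, 0)).1) (ivAt st (tripA.getD q.val (0, 0, 0)).2.1) (ivAt st (tripA.getD q.val (0, 0, 0)).2.2),
     minT (ivAt st (tripA.getD q.val (0, 0, 0)).1) (ivAt st (tripA.getD q.val (0, 0, 0)).2.1) (ivAt st (tripA.getD q.val (0, 0, 0)).2.2))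

/-- The bound test: all three interval bounds are nonnegative. [this work] -/
def bndK (st : KState) : Bool :=
  let b := bsum3 st
  decide (0 ≤ b.1) && decide (0 ≤ b.2.1) && decide (0 ≤ b.2.2)

/-- Some listed cell has an empty interval. [this work] -/
def deadK (d : ℕ) (st : KState) : Bool :=
  (upLaterA.getD d []).any (fun e => ivAt st e == 12) || (downLaterA.getD d []).any (fun e => ivAt st e == 12)

/-- BRANCH AND BOUND: prune when the interval bounds are nonnegative; otherwise branch on the next cell over the labels in its interval with canonical
petal names (`h1`/`h2`: a `1` / a `2` has occurred), propagate, and drop dead branches. [this work] -/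
def dfsK : ℕ → ℕ → KState → Bool → Bool → Bool
  | 0, _, st, _, _ => bndK st
  | n + 1, d, st, h1, h2 => bndK st || vals.all fun x =>
      !memIv (ivAt st d) x || !(decide (x ≠ 2 ∧ x ≠ 3) || h1) || !(decide (x ≠ 3) || h2) ||
        deadK d (propK d x st) || dfsK n (d + 1) (propK d x st) (h1 || x == 1) (h2 || x == 2)

/-- The initial state: every interval full. [this work] -/
def initK : KState := List.replicate 27 topIv

/-- The state reached along a prefix of values. [this work] -/
def stateAlong : ℕ → KState → List (Fin 5) → KState
  | _, st, [] => st
  | d, st, x :: xs => stateAlong (d + 1) (propK d x st) xs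

/-- The state of a prefix. [this work] -/
def stateOfK (pre : List (Fin 5)) : KState := stateAlong 0 initK pre

/-- The search below a prefix. [this work] -/
def dfsFromK (pre : List (Fin 5)) : Bool :=
  dfsK (27 - pre.length) pre.length (stateOfK pre) (pre.contains 1) (pre.contains 2)

/-- The TOP SEARCH with an oracle: identical to `dfsK` but it also carries the prefix of assigned values, and a node whose prefix is listed in `front`
is delegated to a separately checked chunk (`dfsFromK`). [this work] -/
def dfsTop (front : List (List (Fin 5))) : ℕ → ℕ → KState → Bool → Bool → List (Fin 5) → Bool
  | 0, _, st, _, _, pre => front.contains pre || bndK st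
  | n + 1, d, st, h1, h2, pre => front.contains pre || bndK st || vals.all fun x =>
      !memIv (ivAt st d) x || !(decide (x ≠ 2 ∧ x ≠ 3) || h1) || !(decide (x ≠ 3) || h2) ||
        deadK d (propK d x st) || dfsTop front n (d + 1) (propK d x st) (h1 || x == 1) (h2 || x == 2) (pre ++ [x])

/-! ## §3. Soundness -/

/-- The labels of `ψ` lie in the intervals of the state. [this work] -/
def InvK (ψ : Lv → Fin 5) (st : KState) : Prop := st.length = 27 ∧ ∀ e < 27, memIv (ivAt st e) (ψ (cellAt e)) = true

/-- Reading after a `set`. [this work] -/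
theorem ivAt_set (st : KState) (e j : ℕ) (v : Fin 13) :
    ivAt (st.set e v) j = if e = j ∧ e < st.length then v else ivAt st j := by
  simp only [ivAt, List.getD_eq_getElem?_getD, List.getElem?_set]
  by_cases h : e = j
  · subst h
    by_cases hl : e < st.length
    · simp [hl]
    · simp only [hl, if_true, if_false, and_false]
      rw [List.getElem?_eq_none (Nat.le_of_not_lt hl)]
  · simp [h]

/-- A `set` with a member-preserving value keeps the invariant. [this work] -/
theorem invK_set {ψ : Lv → Fin 5} {st : KState} (h : InvK ψ st) (e : ℕ) (v : Fin 13)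
    (hv : e < 27 → memIv v (ψ (cellAt e)) = true) : InvK ψ (st.set e v) := by
  refine ⟨by rw [List.length_set]; exact h.1, fun j hj => ?_⟩
  rw [ivAt_set]
  split_ifs with hc
  · rw [← hc.1]; exact hv (hc.1 ▸ hj)
  · exact h.2 j hj

/-- Raising lower bounds of cells above the assigned cell keeps the invariant. [this work] -/
theorem invK_raiseAll {ψ : Lv → Fin 5} (hψ : IsMonoM3 ψ) {d : ℕ} :
    ∀ (es : List ℕ) (st : KState), (∀ e ∈ es, leB (cellAt d) (cellAt e) = true) → InvK ψ st →
      InvK ψ (raiseAll (ψ (cellAt d)) es st)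
  | [], st, _, h => h
  | e :: es, st, hes, h => by
    refine invK_raiseAll hψ es _ (fun e' he' => hes e' (List.mem_cons_of_mem _ he')) (invK_set h e _ fun he => ?_)
    exact memIv_raiseIv _ _ _ (h.2 e he) (hψ (le_of_leB (hes e List.mem_cons_self)))

/-- Lowering upper bounds of cells below the assigned cell keeps the invariant. [this work] -/
theorem invK_lowerAll {ψ : Lv → Fin 5} (hψ : IsMonoM3 ψ) {d : ℕ} :
    ∀ (es : List ℕ) (st : KState), (∀ e ∈ es, leB (cellAt e) (cellAt d) = true) → InvK ψ st →
      InvK ψ (lowerAll (ψ (cellAt d)) es st)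
  | [], st, _, h => h
  | e :: es, st, hes, h => by
    refine invK_lowerAll hψ es _ (fun e' he' => hes e' (List.mem_cons_of_mem _ he')) (invK_set h e _ fun he => ?_)
    exact memIv_lowerIv _ _ _ (h.2 e he) (hψ (le_of_leB (hes e List.mem_cons_self)))

/-- **Propagating the true next value keeps the invariant.** [this work] -/
theorem invK_propK {ψ : Lv → Fin 5} (hψ : IsMonoM3 ψ) {st : KState} (h : InvK ψ st) {d : ℕ} (hd : d < 27) :
    InvK ψ (propK d (ψ (cellAt d)) st) := by
  unfold propK
  exact invK_lowerAll hψ _ _ (downLaterA_spec d hd) (invK_raiseAll hψ _ _ (upLaterA_spec d hd) (invK_set h d _ fun _ => memIv_singIv _))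

/-- A state satisfying the invariant has no empty interval among the first `27` cells. [this work] -/
theorem ivAt_ne_empty {ψ : Lv → Fin 5} {st : KState} (h : InvK ψ st) {e : ℕ} (he : e < 27) : ivAt st e ≠ 12 := by
  intro hc
  have := h.2 e he
  rw [hc, memIv_empty] at this
  exact Bool.false_ne_true this

/-- Listed cells are among the first `27`. [this work] -/
theorem upLaterA_lt : ∀ d < 27, ∀ e ∈ upLaterA.getD d [], e < 27 := by
  unfold upLaterA; decide
/-- Listed cells are among the first `27`. [this work] -/
theorem downLaterA_lt : ∀ d < 27, ∀ e ∈ downLaterA.getD d [], e < 27 := by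
  unfold downLaterA; decide

/-- Along the true map no branch is dead. [this work] -/
theorem deadK_eq_false {ψ : Lv → Fin 5} {st : KState} (h : InvK ψ st) {d : ℕ} (hd : d < 27) : deadK d st = false := by
  rw [Bool.eq_false_iff]
  intro hdead
  simp only [deadK, Bool.or_eq_true, List.any_eq_true, beq_iff_eq] at hdead
  rcases hdead with ⟨e, he, hc⟩ | ⟨e, he, hc⟩
  · exact ivAt_ne_empty h (upLaterA_lt d hd e he) hc
  · exact ivAt_ne_empty h (downLaterA_lt d hd e he) hc

/-- **The bound test is sound**: if it passes on a state containing `ψ`, the three reduced generic sums of `ψ` are nonnegative. [this work] -/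
theorem T0_nonneg_of_bndK {ψ : Lv → Fin 5} {st : KState} (h : InvK ψ st) (hb : bndK st = true) :
    0 ≤ T0 s6H ψ ∧ 0 ≤ T0 s6G ψ ∧ 0 ≤ T0 s6T ψ := by
  simp only [bndK, Bool.and_eq_true, decide_eq_true_eq] at hb
  obtain ⟨⟨hH, hG⟩, hT⟩ := hb
  have mem : ∀ q : Fin 36, memIv (ivAt st (tripA.getD q.val (0, 0, 0)).1) (ψ (cellAt (tripA.getD q.val (0, 0, 0)).1)) = true ∧
      memIv (ivAt st (tripA.getD q.val (0, 0, 0)).2.1) (ψ (cellAt (tripA.getD q.val (0, 0, 0)).2.1)) = true ∧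
      memIv (ivAt st (tripA.getD q.val (0, 0, 0)).2.2) (ψ (cellAt (tripA.getD q.val (0, 0, 0)).2.2)) = true := by
    intro q
    obtain ⟨hl0, hl1, hl2⟩ := tripA_lt q
    exact ⟨h.2 _ hl0, h.2 _ hl1, h.2 _ hl2⟩
  refine ⟨?_, ?_, ?_⟩
  · rw [← sum_tripA_eq_T0]
    refine le_trans hH ?_
    rw [show (bsum3 st).1 = ∑ q : Fin 36, minH (ivAt st (tripA.getD q.val (0, 0, 0)).1) (ivAt st (tripA.getD q.val (0, 0, 0)).2.1)
        (ivAt st (tripA.getD q.val (0, 0, 0)).2.2) from Prod.fst_sum]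
    exact sum_le_sum fun q _ => minH_le _ _ _ _ _ _ (mem q).1 (mem q).2.1 (mem q).2.2
  · rw [← sum_tripA_eq_T0]
    refine le_trans hG ?_
    rw [show (bsum3 st).2.1 = ∑ q : Fin 36, minG (ivAt st (tripA.getD q.val (0, 0, 0)).1) (ivAt st (tripA.getD q.val (0, 0, 0)).2.1)
        (ivAt st (tripA.getD q.val (0, 0, 0)).2.2) by unfold bsum3; rw [Prod.snd_sum, Prod.fst_sum]]
    exact sum_le_sum fun q _ => minG_le _ _ _ _ _ _ (mem q).1 (mem q).2.1 (mem q).2.2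
  · rw [← sum_tripA_eq_T0]
    refine le_trans hT ?_
    rw [show (bsum3 st).2.2 = ∑ q : Fin 36, minT (ivAt st (tripA.getD q.val (0, 0, 0)).1) (ivAt st (tripA.getD q.val (0, 0, 0)).2.1)
        (ivAt st (tripA.getD q.val (0, 0, 0)).2.2) by unfold bsum3; rw [Prod.snd_sum, Prod.snd_sum]]
    exact sum_le_sum fun q _ => minT_le _ _ _ _ _ _ (mem q).1 (mem q).2.1 (mem q).2.2

/-- **SOUNDNESS OF THE BRANCH AND BOUND**: along a good map `ψ` contained in the state, success forces the three reduced generic sums of `ψ` to be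
nonnegative. [this work] -/
theorem dfsK_sound (ψ : Lv → Fin 5) (hψ : IsGood cellAt ψ) :
    ∀ (n d : ℕ) (st : KState) (h1 h2 : Bool), d + n = 27 → InvK ψ st →
      ((∃ e < d, ψ (cellAt e) = 1) → h1 = true) → ((∃ e < d, ψ (cellAt e) = 2) → h2 = true) →
      dfsK n d st h1 h2 = true → 0 ≤ T0 s6H ψ ∧ 0 ≤ T0 s6G ψ ∧ 0 ≤ T0 s6T ψ
  | 0, d, st, h1, h2, _, hinv, _, _, h => T0_nonneg_of_bndK hinv h
  | n + 1, d, st, h1, h2, hdn, hinv, hf1, hf2, h => by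
    have hd : d < 27 := by omega
    have h' : (bndK st || vals.all fun x => !memIv (ivAt st d) x || !(decide (x ≠ 2 ∧ x ≠ 3) || h1) || !(decide (x ≠ 3) || h2) ||
        deadK d (propK d x st) || dfsK n (d + 1) (propK d x st) (h1 || x == 1) (h2 || x == 2)) = true := h
    rw [Bool.or_eq_true] at h'
    rcases h' with hb | hall
    · exact T0_nonneg_of_bndK hinv hb
    · rw [List.all_eq_true] at hall
      have hx := hall (ψ (cellAt d)) (mem_vals _)
      have g1 : memIv (ivAt st d) (ψ (cellAt d)) = true := hinv.2 d hd
      have g2 : (decide (ψ (cellAt d) ≠ 2 ∧ ψ (cellAt d) ≠ 3) || h1) = true := by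
        rw [Bool.or_eq_true, decide_eq_true_eq]
        by_cases h23 : ψ (cellAt d) = 2 ∨ ψ (cellAt d) = 3
        · exact Or.inr (hf1 (hψ.2.1 d hd h23))
        · push Not at h23; exact Or.inl h23
      have g3 : (decide (ψ (cellAt d) ≠ 3) || h2) = true := by
        rw [Bool.or_eq_true, decide_eq_true_eq]
        by_cases h3 : ψ (cellAt d) = 3
        · exact Or.inr (hf2 (hψ.2.2 d hd h3))
        · exact Or.inl h3
      have hinv' : InvK ψ (propK d (ψ (cellAt d)) st) := invK_propK hψ.1 hinv hd
      have g4 : deadK d (propK d (ψ (cellAt d)) st) = false := deadK_eq_false hinv' hd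
      rw [g1, g2, g3, g4] at hx
      simp only [Bool.not_true, Bool.false_or] at hx
      refine dfsK_sound ψ hψ n (d + 1) _ _ _ (by omega) hinv' (fun ⟨e, he, he1⟩ => ?_) (fun ⟨e, he, he2⟩ => ?_) hx
      · rw [Bool.or_eq_true]
        rcases Nat.lt_succ_iff_lt_or_eq.1 he with he' | he'
        · exact Or.inl (hf1 ⟨e, he', he1⟩)
        · subst he'; exact Or.inr (by rw [he1]; decide)
      · rw [Bool.or_eq_true]
        rcases Nat.lt_succ_iff_lt_or_eq.1 he with he' | he'
        · exact Or.inl (hf2 ⟨e, he', he2⟩)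
        · subst he'; exact Or.inr (by rw [he2]; decide)

/-- The prefix of `ψ` of length `d` along the cell order. [this work] -/
def prefixOf (ψ : Lv → Fin 5) (d : ℕ) : List (Fin 5) := (List.range d).map fun e => ψ (cellAt e)

/-- Length of the prefix. [this work] -/
theorem length_prefixOf (ψ : Lv → Fin 5) (d : ℕ) : (prefixOf ψ d).length = d := by
  simp [prefixOf]

/-- Extending the prefix. [this work] -/
theorem prefixOf_succ (ψ : Lv → Fin 5) (d : ℕ) : prefixOf ψ (d + 1) = prefixOf ψ d ++ [ψ (cellAt d)] := by
  simp [prefixOf, List.range_succ]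

/-- Membership in the prefix. [this work] -/
theorem contains_prefixOf (ψ : Lv → Fin 5) (d : ℕ) (y : Fin 5) :
    (∃ e < d, ψ (cellAt e) = y) → (prefixOf ψ d).contains y = true := by
  rintro ⟨e, he, hey⟩
  rw [List.contains_iff_mem]
  simp only [prefixOf, List.mem_map, List.mem_range]
  exact ⟨e, he, hey⟩

/-- The state of a prefix, unfolded one step. [this work] -/
theorem stateAlong_append (d : ℕ) (st : KState) :
    ∀ (pre : List (Fin 5)) (x : Fin 5), stateAlong d st (pre ++ [x]) = propK (d + pre.length) x (stateAlong d st pre)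
  | [], x => by simp [stateAlong]
  | y :: ys, x => by
    simp only [List.cons_append, stateAlong, List.length_cons]
    rw [stateAlong_append (d + 1) _ ys x]
    congr 1
    omega

/-- The state of the prefix of `ψ` contains `ψ`. [this work] -/
theorem invK_stateOfK_prefixOf {ψ : Lv → Fin 5} (hψ : IsMonoM3 ψ) : ∀ d ≤ 27, InvK ψ (stateOfK (prefixOf ψ d))
  | 0, _ => by
    refine ⟨by simp [prefixOf, stateOfK, stateAlong, initK], fun e he => ?_⟩
    simp only [prefixOf, List.range_zero, List.map_nil, stateOfK, stateAlong, ivAt, initK, List.getD_eq_getElem?_getD,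
      List.getElem?_replicate, he, if_true, Option.getD_some]
    exact memIv_topIv _
  | d + 1, hd => by
    rw [prefixOf_succ, stateOfK, stateAlong_append, length_prefixOf, Nat.zero_add]
    exact invK_propK hψ (invK_stateOfK_prefixOf hψ d (by omega)) (by omega)

/-- **SOUNDNESS OF THE TOP SEARCH**: if the top search succeeds and every listed chunk succeeds, the three reduced generic sums of every good map are
nonnegative. [this work] -/
theorem dfsTop_sound (front : List (List (Fin 5))) (hfront : ∀ pre ∈ front, dfsFromK pre = true) (ψ : Lv → Fin 5) (hψ : IsGood cellAt ψ) :
    ∀ (n d : ℕ) (st : KState) (h1 h2 : Bool), d + n = 27 → InvK ψ st →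
      ((∃ e < d, ψ (cellAt e) = 1) → h1 = true) → ((∃ e < d, ψ (cellAt e) = 2) → h2 = true) →
      dfsTop front n d st h1 h2 (prefixOf ψ d) = true → 0 ≤ T0 s6H ψ ∧ 0 ≤ T0 s6G ψ ∧ 0 ≤ T0 s6T ψ := by
  have hchunk : ∀ d ≤ 27, front.contains (prefixOf ψ d) = true → 0 ≤ T0 s6H ψ ∧ 0 ≤ T0 s6G ψ ∧ 0 ≤ T0 s6T ψ := by
    intro d hd hc
    have h := hfront _ (List.contains_iff_mem.1 hc)
    unfold dfsFromK at h
    rw [length_prefixOf] at h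
    exact dfsK_sound ψ hψ (27 - d) d _ _ _ (by omega) (invK_stateOfK_prefixOf hψ.1 d hd) (contains_prefixOf ψ d 1)
      (contains_prefixOf ψ d 2) h
  intro n
  induction n with
  | zero =>
    intro d st h1 h2 hdn hinv _ _ h
    have h' : (front.contains (prefixOf ψ d) || bndK st) = true := h
    rw [Bool.or_eq_true] at h'
    rcases h' with hc | hb
    · exact hchunk d (by omega) hc
    · exact T0_nonneg_of_bndK hinv hb
  | succ n ih =>
    intro d st h1 h2 hdn hinv hf1 hf2 h
    have hd : d < 27 := by omega
    have h' : (front.contains (prefixOf ψ d) || bndK st || vals.all fun x =>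
        !memIv (ivAt st d) x || !(decide (x ≠ 2 ∧ x ≠ 3) || h1) || !(decide (x ≠ 3) || h2) ||
        deadK d (propK d x st) || dfsTop front n (d + 1) (propK d x st) (h1 || x == 1) (h2 || x == 2) (prefixOf ψ d ++ [x])) = true := h
    rw [Bool.or_eq_true, Bool.or_eq_true] at h'
    rcases h' with (hc | hb) | hall
    · exact hchunk d (by omega) hc
    · exact T0_nonneg_of_bndK hinv hb
    · rw [List.all_eq_true] at hall
      have hx := hall (ψ (cellAt d)) (mem_vals _)
      have g1 : memIv (ivAt st d) (ψ (cellAt d)) = true := hinv.2 d hd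
      have g2 : (decide (ψ (cellAt d) ≠ 2 ∧ ψ (cellAt d) ≠ 3) || h1) = true := by
        rw [Bool.or_eq_true, decide_eq_true_eq]
        by_cases h23 : ψ (cellAt d) = 2 ∨ ψ (cellAt d) = 3
        · exact Or.inr (hf1 (hψ.2.1 d hd h23))
        · push Not at h23; exact Or.inl h23
      have g3 : (decide (ψ (cellAt d) ≠ 3) || h2) = true := by
        rw [Bool.or_eq_true, decide_eq_true_eq]
        by_cases h3 : ψ (cellAt d) = 3
        · exact Or.inr (hf2 (hψ.2.2 d hd h3))
        · exact Or.inl h3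
      have hinv' : InvK ψ (propK d (ψ (cellAt d)) st) := invK_propK hψ.1 hinv hd
      have g4 : deadK d (propK d (ψ (cellAt d)) st) = false := deadK_eq_false hinv' hd
      rw [g1, g2, g3, g4, ← prefixOf_succ] at hx
      simp only [Bool.not_true, Bool.false_or] at hx
      refine ih (d + 1) _ _ _ (by omega) hinv' (fun ⟨e, he, he1⟩ => ?_) (fun ⟨e, he, he2⟩ => ?_) hx
      · rw [Bool.or_eq_true]
        rcases Nat.lt_succ_iff_lt_or_eq.1 he with he' | he'
        · exact Or.inl (hf1 ⟨e, he', he1⟩)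
        · subst he'; exact Or.inr (by rw [he1]; decide)
      · rw [Bool.or_eq_true]
        rcases Nat.lt_succ_iff_lt_or_eq.1 he with he' | he'
        · exact Or.inl (hf2 ⟨e, he', he2⟩)
        · subst he'; exact Or.inr (by rw [he2]; decide)

/-- **From a successful chunked search to COMB_chain of every height-two three-block quotient** (standard axioms). [this work] -/
theorem comb_height_two_of_dfsTop (front : List (List (Fin 5))) (hfront : ∀ pre ∈ front, dfsFromK pre = true)
    (htop : dfsTop front 27 0 initK false false [] = true) (G : Sunflower (Σ _b : Fin 3, Fin 2)) (c : ∀ _b : Fin 3, Fin 3 → Fin 3) :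
    0 ≤ ZFC s6H G c ∧ 0 ≤ ZFC s6G G c ∧ 0 ≤ ZFC s6T G c := by
  have hgood : ∀ ψ : Lv → Fin 5, IsGood cellAt ψ → 0 ≤ T0 s6H ψ ∧ 0 ≤ T0 s6G ψ ∧ 0 ≤ T0 s6T ψ :=
    fun ψ hψ => dfsTop_sound front hfront ψ hψ 27 0 initK false false rfl (invK_stateOfK_prefixOf hψ.1 0 (by omega))
      (fun ⟨_, he, _⟩ => absurd he (Nat.not_lt_zero _)) (fun ⟨_, he, _⟩ => absurd he (Nat.not_lt_zero _)) htop
  have hmono : ∀ ψ : Lv → Fin 5, IsMonoM3 ψ → 0 ≤ Tgen s6H ψ ∧ 0 ≤ Tgen s6G ψ ∧ 0 ≤ Tgen s6T ψ := by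
    intro ψ hψ
    obtain ⟨ψ', hg', hT⟩ := exists_good cellAt ψ hψ
    obtain ⟨hH, hG, hT'⟩ := hgood ψ' hg'
    rw [hT s6H isPetalInv_s6H] at hH
    rw [hT s6G isPetalInv_s6G] at hG
    rw [hT s6T isPetalInv_s6T] at hT'
    rw [Tgen_eq_six_mul_T0 isSym3_s6H, Tgen_eq_six_mul_T0 isSym3_s6G, Tgen_eq_six_mul_T0 isSym3_s6T]
    exact ⟨by positivity, by positivity, by positivity⟩
  exact ⟨comb_of_Tgen s6H (fun ψ hψ => (hmono ψ hψ).1) G c, comb_of_Tgen s6G (fun ψ hψ => (hmono ψ hψ).2.1) G c,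
    comb_of_Tgen s6T (fun ψ hψ => (hmono ψ hψ).2.2) G c⟩

end ThreeBlockComb

end Summit.CriticalPhenomena.PercolationContinuityZ3.Theorems.SunflowerPartition
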